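/-
COR-CM (cell pub-hodgecm2, stage 2 of the Hodge ladder) — count-neutral KERNEL COMBINATORICS «the index-two cyclic law», part XXI: THE MIXED TWISTS,
II — THE OCTIC LEVEL (seat prover-pub-hodgecm2-b23-g56-0, binder prover b23, gen 56; claim «INDEX-TWO CYCLIC — THE MIXED TWISTS», HOME/INBOX.md
l.26438).  Theorems only, on part XX and seat b23 gen 45ʼs OCTIC PRODUCT LAW (`OcticProduct.isLeast_card_gfaces_generate_cyclic`,
`OcticProduct.exhaust_of_card`) BY NAME; no definition, no `decide`, no certificate, no named fact, no `sorry`; `Interfaces.lean` (C1), every E term,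
B01, `Transposition/*`, `PortJoin/*`, `D2Bridge/*` untouched.
HONEST FRAMING: `HC_CM` is NOT proved, here or anywhere in the tree; nothing here is a period, a count of record or a headline.
T5: n/a-class (hypothesis binders = the fields of `IndexTwoCyclic.Datum`, `c·c = 1`, `c ∉ ⟨u^{r+1}⟩`, `u^{r+1} ≠ 1`, `n = 2·orderOf u^{r+1}` —
inhabited by `ℤ/12 ⋊₇ ℤ/2 = D₄ × ℤ/3` (part VIIʼs `SplitGroup 6 7`); checker: self).
-/
import Summits.HodgeConjecture.CorCM.Census.IndexTwoCyclicMixedStructure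
import Summits.HodgeConjecture.CorCM.Census.OcticProductCyclic
import Summits.HodgeConjecture.CorCM.Census.OcticProductExhaust
import Summits.HodgeConjecture.CorCM.Census.IndexTwoCyclicQuaternion

/-!
# The index-two cyclic law, XXI: the mixed twists, II — the octic level `n = 2·orderOf u^{r+1}` is an octic product

THE SETTING of part XX: an index-two cyclic datum `D` for `(G, c)` with `c ∉ ⟨v⟩`, `v = u^{r+1}` (`d₂ = 0`), `j = orderOf v` (odd), so that
`G = ⟨uʲ, w⟩ × ⟨v⟩` with `⟨uʲ, w⟩` dihedral of order `4n/j` ∋ `c`.  When the dihedral factor has order `8` — **`n = 2j`**, `t := uʲ` of order `4`,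
`t² = c` — the group is `D₄ × C_j` with `c = r²`, and seat b23 gen 45ʼs OCTIC PRODUCT LAW applies:

* §1 **the octic product datum** (`exists_octicProductDatum`): `ι(a, b) = cᵃ vᵇ : ℤ/2 × ℤ/j ↪ G` (central), `y = w` (`y² = 1`: square class
  `ζ = 0`), `t = uʲ` (`t² = c`, `w t = c t w`), the four cosets exhaust `G` (`|G| = 4n = 8j`, gen 45ʼs `exhaust_of_card`);
* §2 **THE LAW AT THE OCTIC LEVEL** (`isLeast_card_gfaces_generate_fibreTwo_of_octic_level`): `c ∉ ⟨u^{r+1}⟩`, `u^{r+1} ≠ 1`, `n = 2·orderOf u^{r+1}`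
  ⟹ **`μ(G, c) = φ₂(G, c) = β − 2`** — the mixed twists `(2n, r) = (4j, r)` with `r ≡ 3 (mod 4)`, `r ≡ 1 (mod j)`, `j` odd `≥ 3`
  (`(12,7) = D₄×C₃`, `(20,11) = D₄×C₅`, `(28,15)`, `(36,19)`, `(60,31) = D₄×C₁₅`, …: every `D₄ × C_j`, also for composite `j`), closing part IXʼs window
  `β − 2 ≤ μ ≤ β − 1` at this level.  The dihedral factors of order `≥ 16` (`D(ℤ/8) × C₃ = (24, 7)`, order `48`, …) remain open (design note
  `HOME/pub-hodgecm2-b23/MIXED-TWISTS.md`).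

## References
* [Pohlmann1968] H. Pohlmann, Algebraic cycles on abelian varieties of complex multiplication type, Ann. of Math. 88 (1968), Thm 1.
* [Milne1999] J. S. Milne, Lefschetz motives and the Tate conjecture, Compositio Math. 117 (1999), Prop. 2.1, p. 54.
-/

namespace Summit.HodgeConjecture.CorCM.Census.IndexTwoCyclic

open Finset
open Summit.HodgeConjecture.CorCM.Prior.AllgGroup.RfwfAllgGroup
open Summit.HodgeConjecture.CorCM.Census.BlockParity
open Summit.HodgeConjecture.CorCM.Census.Coinvariant

noncomputable section

variable {G : Type*} [Group G] [Fintype G] [DecidableEq G] {c : G} {n : ℕ} [NeZero n]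
variable (D : Datum G c n)

/-! ## §1 The octic product datum at the level `n = 2j` -/

omit [DecidableEq G] [NeZero n] in
/-- At the octic level `t = uʲ` has order `4`. [folklore] -/
theorem orderOf_pow_orderOf_twist_eq_four (hn : n = 2 * orderOf (D.u ^ (D.r + 1))) :
    orderOf (D.u ^ orderOf (D.u ^ (D.r + 1))) = 4 := by
  have e : 2 * n = orderOf (D.u ^ (D.r + 1)) * 4 := by omega
  rw [orderOf_pow_orderOf_twist D, e, Nat.mul_div_cancel_left _ (orderOf_pos _)]

omit [Fintype G] [DecidableEq G] [NeZero n] in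
/-- At the octic level `t² = c`. [folklore] -/
theorem pow_orderOf_twist_mul_self (hn : n = 2 * orderOf (D.u ^ (D.r + 1))) :
    D.u ^ orderOf (D.u ^ (D.r + 1)) * D.u ^ orderOf (D.u ^ (D.r + 1)) = c := by
  rw [← pow_add, ← two_mul, ← hn, D.hun]

omit [DecidableEq G] in
/-- **THE OCTIC PRODUCT DATUM.**  If `c ∉ ⟨u^{r+1}⟩` and `n = 2·orderOf u^{r+1}`, then `(G, c)` carries an octic product datum of square class `0`
over `ℤ/j`, `j = orderOf u^{r+1}`: `G ≅ D₄ × ℤ/j` with `c = r²`. [folklore] -/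
theorem nonempty_octicProductDatum (hc2 : c * c = 1) (hc1 : c ≠ 1) (h : c ∉ Subgroup.zpowers (D.u ^ (D.r + 1)))
    (hn : n = 2 * orderOf (D.u ^ (D.r + 1))) :
    Nonempty (OcticProduct.Datum G c (ZMod (orderOf (D.u ^ (D.r + 1)))) 0) := by
  classical
  set v := D.u ^ (D.r + 1) with hvdef
  set j := orderOf v with hjdef
  set t := D.u ^ j with htdef
  haveI : NeZero j := ⟨(orderOf_pos v).ne'⟩
  have hodd : Odd j := odd_orderOf_twist D h
  have hordc : orderOf c = 2 := orderOf_eq_prime (by rw [pow_two, hc2]) hc1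
  have hcen : ∀ x : G, x * c = c * x := fun x => by have e := D.comm_pow_n x; rwa [D.hun] at e
  have hcv : Commute c v := (hcen v).symm
  have ht4 : orderOf t = 4 := orderOf_pow_orderOf_twist_eq_four D hn
  have htt : t * t = c := pow_orderOf_twist_mul_self D hn
  -- the embedding `ι (a, b) = cᵃ vᵇ`
  set ι : ZMod 2 × ZMod j → G := fun ab => c ^ ab.1.val * v ^ ab.2.val with hι
  have hcpow : ∀ a b : ZMod 2, c ^ (a + b).val = c ^ a.val * c ^ b.val := fun a b => by
    rw [← pow_add, pow_inj_mod, hordc, ZMod.val_add, Nat.mod_mod]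
  have hvpow : ∀ a b : ZMod j, v ^ (a + b).val = v ^ a.val * v ^ b.val := fun a b => by
    rw [← pow_add, pow_inj_mod, ← hjdef, ZMod.val_add, Nat.mod_mod]
  have hadd : ∀ a b, ι (a + b) = ι a * ι b := fun a b => by
    simp only [hι, Prod.fst_add, Prod.snd_add]
    rw [hcpow, hvpow, (hcv.pow_pow b.1.val a.2.val).mul_mul_mul_comm]
  have hιu : ∀ a, ι a ∈ Subgroup.zpowers D.u := fun a => by
    refine mul_mem (Subgroup.pow_mem _ ?_ _) (Subgroup.pow_mem _ (Subgroup.pow_mem _ (Subgroup.mem_zpowers _) _) _)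
    have e := Subgroup.pow_mem (Subgroup.zpowers D.u) (Subgroup.mem_zpowers D.u) n
    rwa [D.hun] at e
  have hinj : Function.Injective ι := by
    rintro ⟨a1, a2⟩ ⟨b1, b2⟩ hab
    simp only [hι] at hab
    have hg : (c ^ b1.val)⁻¹ * c ^ a1.val = v ^ b2.val * (v ^ a2.val)⁻¹ := by
      rw [inv_mul_eq_iff_eq_mul, ← mul_assoc, eq_mul_inv_iff_mul_eq]
      exact hab
    have hg1 : (c ^ b1.val)⁻¹ * c ^ a1.val = 1 := by
      have h2 : orderOf ((c ^ b1.val)⁻¹ * c ^ a1.val) ∣ 2 := by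
        have hmem : (c ^ b1.val)⁻¹ * c ^ a1.val ∈ Subgroup.zpowers c :=
          mul_mem (inv_mem (Subgroup.pow_mem _ (Subgroup.mem_zpowers c) b1.val)) (Subgroup.pow_mem _ (Subgroup.mem_zpowers c) a1.val)
        have := (Subgroup.zpowers c).orderOf_dvd_natCard hmem
        rwa [Nat.card_zpowers, hordc] at this
      have hj' : orderOf ((c ^ b1.val)⁻¹ * c ^ a1.val) ∣ j := by
        rw [hg]
        have hmem : v ^ b2.val * (v ^ a2.val)⁻¹ ∈ Subgroup.zpowers v :=
          mul_mem (Subgroup.pow_mem _ (Subgroup.mem_zpowers v) b2.val) (inv_mem (Subgroup.pow_mem _ (Subgroup.mem_zpowers v) a2.val))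
        have := (Subgroup.zpowers v).orderOf_dvd_natCard hmem
        rwa [Nat.card_zpowers] at this
      have h1 : orderOf ((c ^ b1.val)⁻¹ * c ^ a1.val) ∣ 1 := by
        rw [← (Nat.coprime_two_left.mpr hodd).gcd_eq_one]
        exact Nat.dvd_gcd h2 hj'
      exact orderOf_eq_one_iff.mp (Nat.dvd_one.mp h1)
    have hc' : c ^ b1.val = c ^ a1.val := inv_mul_eq_one.mp hg1
    have hv' : v ^ b2.val = v ^ a2.val := by
      rw [hg1] at hg
      exact mul_inv_eq_one.mp hg.symm
    have e1 : b1.val = a1.val := by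
      have := pow_inj_mod.mp hc'
      rwa [hordc, Nat.mod_eq_of_lt (ZMod.val_lt b1), Nat.mod_eq_of_lt (ZMod.val_lt a1)] at this
    have e2 : b2.val = a2.val := by
      have := pow_inj_mod.mp hv'
      rwa [← hjdef, Nat.mod_eq_of_lt (ZMod.val_lt b2), Nat.mod_eq_of_lt (ZMod.val_lt a2)] at this
    exact Prod.ext (ZMod.val_injective _ e1.symm) (ZMod.val_injective _ e2.symm)
  -- `y = w` centralises `ι`, squares to `1 = ι 0`
  have hwv : Commute D.w v := w_mul_twist D
  have hy_mul : ∀ a, D.w * ι a = ι a * D.w := fun a =>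
    ((Commute.pow_right (D.w_mul_c : Commute D.w c) a.1.val).mul_right (hwv.pow_right a.2.val)).eq
  have hyy : D.w * D.w = ι (((0 : ℕ) : ZMod 2), 0) := by
    simp only [hι, ZMod.val_zero, pow_zero, mul_one, Nat.cast_zero]
    exact D.hww
  -- `t = uʲ` centralises `ι`, `t² = c`, `w t = c t w`
  have htc : Commute t c := by rw [← D.hun]; exact Commute.pow_pow_self D.u _ _
  have htv : Commute t v := Commute.pow_pow_self D.u _ _
  have ht_mul : ∀ a, t * ι a = ι a * t := fun a => ((htc.pow_right a.1.val).mul_right (htv.pow_right a.2.val)).eq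
  have ht_inv : t⁻¹ = c * t := inv_eq_of_mul_eq_one_right (by rw [← mul_assoc, (htc.eq), mul_assoc, htt, hc2])
  have hy_t : D.w * t = c * t * D.w := by rw [htdef, w_mul_pow_orderOf_twist D, ← htdef, ht_inv]
  have hy_ne : ∀ a, D.w ≠ ι a := fun a e => D.hw (e ▸ hιu a)
  have ht_ne : ∀ a, t ≠ ι a := fun a e => by
    -- `v^b = cᵃ·t ∈ ⟨t⟩ ∩ ⟨v⟩ = 1`, so `t = cᵃ` would have order ≤ 2
    simp only [hι] at e
    have hvb : v ^ a.2.val = c ^ a.1.val * t := by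
      rw [e, ← mul_assoc, ← pow_add, ← two_mul, pow_mul, pow_two, hc2, one_pow, one_mul]
    have hvb_t : v ^ a.2.val ∈ Subgroup.zpowers t := by
      rw [hvb]
      exact mul_mem (Subgroup.pow_mem _ (c_mem_zpowers_pow_orderOf_twist D h) _) (Subgroup.mem_zpowers t)
    have hvb1 : v ^ a.2.val = 1 :=
      eq_one_of_mem_zpowers_of_mem_zpowers_twist D h hvb_t (Subgroup.pow_mem _ (Subgroup.mem_zpowers v) _)
    have htc' : t = c ^ a.1.val := by
      have e' := hvb.symm
      rw [hvb1] at e'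
      -- `cᵃ · t = 1` ⟹ `t = (cᵃ)⁻¹ = cᵃ`
      have := eq_inv_of_mul_eq_one_right e'
      rw [this, ← inv_pow, inv_eq_of_mul_eq_one_right hc2]
    have h2 : orderOf t ∣ 2 := by
      rw [htc', orderOf_dvd_iff_pow_eq_one, ← pow_mul, mul_comm, pow_mul, pow_two, hc2, one_pow]
    rw [ht4] at h2
    exact absurd h2 (by norm_num)
  have ht_ne' : ∀ a, t ≠ D.w * ι a := fun a e => by
    rw [hy_mul] at e
    exact D.mul_w_notMem (hιu a) (e ▸ Subgroup.pow_mem _ (Subgroup.mem_zpowers D.u) _)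
  have hcardA : Fintype.card G = 8 * Fintype.card (ZMod j) := by rw [ZMod.card, card_eq_four_mul D.hord D.hindex, hn]; ring
  have hyy0 : D.w * D.w = ι ((0 : ZMod 2), 0) := by rw [hyy, Nat.cast_zero]
  have hexh := OcticProduct.exhaust_of_card (ζ := 0) ι D.w t hadd hinj hy_mul hyy0 hy_ne ht_ne ht_ne' hcardA
  have hmap_c : ι (1, 0) = c := by
    simp only [hι, ZMod.val_zero, pow_zero, mul_one]
    rw [ZMod.val_one, pow_one]
  let D' : OcticProduct.Datum G c (ZMod j) 0 :=
    { ι := ι, y := D.w, t := t, map_add := hadd, map_c := hmap_c, y_mul := hy_mul, y_mul_y := hyy0, t_mul := ht_mul,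
      t_mul_t := htt, y_mul_t := hy_t, inj := hinj, y_ne := hy_ne, t_ne := ht_ne, t_ne' := ht_ne', exhaust := hexh }
  exact ⟨D'⟩

/-! ## §2 The law at the octic level -/

omit [DecidableEq G] [NeZero n] in
/-- `j = orderOf u^{r+1} ≥ 3` for a non-dihedral mixed twist (`j` odd, `j ≠ 1`). [folklore] -/
theorem three_le_orderOf_twist (h : c ∉ Subgroup.zpowers (D.u ^ (D.r + 1))) (hv : D.u ^ (D.r + 1) ≠ 1) :
    3 ≤ orderOf (D.u ^ (D.r + 1)) := by
  obtain ⟨m, hm⟩ := odd_orderOf_twist D h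
  have h1 : orderOf (D.u ^ (D.r + 1)) ≠ 1 := fun e => hv (orderOf_eq_one_iff.mp e)
  omega

/-- **THE INDEX-TWO CYCLIC LAW AT THE OCTIC LEVEL OF THE MIXED TWISTS: `μ(G, c) = φ₂(G, c)`.**  For an index-two cyclic datum with
`c ∉ ⟨u^{r+1}⟩`, `u^{r+1} ≠ 1` and `n = 2·orderOf u^{r+1}` — `G ≅ D₄ × C_j`, `j = orderOf u^{r+1}` odd `≥ 3`, every such `j` — the least number
of rank-four face relations whose base changes together with the pairs generate the integer Hodge lattice is the coinvariant fibre. [folklore] -/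
theorem isLeast_card_gfaces_generate_fibreTwo_of_octic_level (hc2 : c * c = 1) (hc1 : c ≠ 1) (h : c ∉ Subgroup.zpowers (D.u ^ (D.r + 1)))
    (hv : D.u ^ (D.r + 1) ≠ 1) (hn : n = 2 * orderOf (D.u ^ (D.r + 1))) :
    IsLeast {m : ℕ | ∃ S : Finset (CMF G c →₀ ℤ), ↑S ⊆ gfaceSet G c hc2 ∧ S.card = m ∧
      hodgeSpan c hc2 ≤ Submodule.span ℤ (pairSet c) ⊔ Submodule.span ℤ (translates c S)} (fibreTwo c hc2) := by
  haveI : NeZero (orderOf (D.u ^ (D.r + 1))) := ⟨(orderOf_pos _).ne'⟩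
  obtain ⟨D'⟩ := nonempty_octicProductDatum D hc2 hc1 h hn
  exact OcticProduct.isLeast_card_gfaces_generate_cyclic D' hc2 (odd_orderOf_twist D h) (three_le_orderOf_twist D h hv)

/-- **Block currency: `μ = β − 2` at the octic level of the mixed twists** (part IX: `β = φ₂ + 2` whenever `c ∉ ⟨u^{r+1}⟩`). [folklore] -/
theorem isLeast_card_gfaces_generate_of_octic_level (hc2 : c * c = 1) (hc1 : c ≠ 1) (h : c ∉ Subgroup.zpowers (D.u ^ (D.r + 1)))
    (hv : D.u ^ (D.r + 1) ≠ 1) (hn : n = 2 * orderOf (D.u ^ (D.r + 1))) :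
    IsLeast {m : ℕ | ∃ S : Finset (CMF G c →₀ ℤ), ↑S ⊆ gfaceSet G c hc2 ∧ S.card = m ∧
      hodgeSpan c hc2 ≤ Submodule.span ℤ (pairSet c) ⊔ Submodule.span ℤ (translates c S)} (Fintype.card (Block c) - 2) := by
  have hβ := card_block_eq_fibreTwo_add_two_of_notMem D hc2 hc1 h
  rw [hβ, Nat.add_sub_cancel]
  exact isLeast_card_gfaces_generate_fibreTwo_of_octic_level D hc2 hc1 h hv hn

end

end Summit.HodgeConjecture.CorCM.Census.IndexTwoCyclic
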